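import Mathlib
import Summits.Ventures.PercRepro.TriangleCapFourRowThreePieces

/-!
# PercRepro — THE ROW `a = 4` AT `r = 3`: a `K₄⁻`-free graph with `4 (k − 4) − 3` edges on `k ≥ 11` vertices is
`4`-bipartite or at least `B2 = 2k − 18` below the closed form (p3, gen 46; part 199d)

The first cell of the stability table §10bt(e) at `r ≥ 3` (the conjecture `min {B1, B2, T}` of the non-bipartite gap
reads `B2 = 2 (k − 2a − 1)(a − r) = 2k − 18` on `(k, 4, 3)`, below `T = 2k − 16`; the census (kit j315861) has the
corner `(11, 4, 3)` at gap `4 = B2` exactly, `15,246` maximisers). The proof is the induction on `k` of parts 195–198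
(every vertex type): a vertex at the cap `k − 4` is part 199b (`four_three_cap`); every degree in `[5, k − 5]` gives
`k (k − 9) ≥ 2k − 18` by the convexity of the row `5` (`below_convex_gen`); a vertex `z` of degree `d ≤ 4` is deleted
and `D − z` read on its cell at `k − 1` (part 199c): `d = 0` the closed form on `(k − 1, 5, k − 11)`; `d = 1` the
diagonal `(k − 1, 4, 0)` at second order; `d = 2` the cell `(k − 1, 4, 1)`; `d = 3` the cell `(k − 1, 4, 2)`; `d = 4`
the cell `(k − 1, 4, 3)` — the induction hypothesis for `k ≥ 12` and, AT THE CORNER `k = 11`, the third order on the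
diagonal `(10, 21)` of part 199a (`three_diag_third_order_ten`: `D − z` is `K_{3,7}`, whose four neighbours of `z` lie
off the `3`-side, so `D` is `4`-bipartite; or `4`-bipartite; or at most `190`). Whenever `D − z` is `4`-bipartite the
side lemma `four_three_sides` applies. `four_three_corner`: on `(11, 4, 3)` every non-`4`-bipartite graph has
`Σ_v d(v)² ≤ 250`. Axioms: standard.
-/

namespace PercRepro

namespace TriangleCap

namespace C047

open Finset

universe u

variable {V : Type*} [Fintype V] [DecidableEq V]

/-- **THE ROW `a = 4` AT `r = 3`, EVERY VERTEX TYPE, BY INDUCTION ON `k`:** `K₄⁻`-free, `m + 3 = 4 (k − 4)`,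
`11 ≤ k` ⇒ `4`-bipartite or `Σ_v d(v)² + 3 (k − 4) + (2k − 18) ≤ m k`. -/
theorem four_three_second_order_aux (n : ℕ) :
    ∀ (W : Type u) [Fintype W] [DecidableEq W] (D : SimpleGraph W) [DecidableRel D.Adj], Fintype.card W = n →
      K4mFree D → 11 ≤ Fintype.card W → D.edgeFinset.card + 3 = 4 * (Fintype.card W - 4) →
      (∃ A : Finset W, A.card = 4 ∧ BipSub D A) ∨
        ∑ v, deg D v * deg D v + 3 * (Fintype.card W - 4) + (2 * Fintype.card W - 18) ≤
          D.edgeFinset.card * Fintype.card W := by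
  refine Nat.strong_induction_on n ?_
  intro n ih W _ _ D _ hn hK hk hm
  -- (A) a vertex at the cap `k − 4`
  by_cases hx : ∃ x, deg D x + 4 = Fintype.card W
  · obtain ⟨x, hx⟩ := hx
    exact four_three_cap D hK hk hm x hx
  push Not at hx
  have hcap : ∀ v, deg D v + 4 ≤ Fintype.card W := fun v =>
    deg_add_le_card_of_dense D hK 4 (by norm_num) (by omega)
      (cap_arith 4 (Fintype.card W) D.edgeFinset.card 3 (by norm_num) (by omega) (by omega)) v
  have hcap' : ∀ v, deg D v + 5 ≤ Fintype.card W := fun v => by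
    have h1 := hcap v
    have h2 := hx v
    omega
  have hcap6 : ∀ v, deg D v ≤ (Fintype.card W - 6) + 1 := fun v => by have := hcap' v; omega
  -- (B) every degree `≥ 5`: the convexity of the row `5`
  by_cases hdeg : ∀ v, 5 ≤ deg D v
  · right
    have h := below_convex_gen D 4 3 (by norm_num) (by omega) hm hcap' hdeg
    have h2 : 2 * (Fintype.card W - 2 * 4 - 1) ≤ Fintype.card W * (Fintype.card W - 2 * 4 - 1) :=
      Nat.mul_le_mul_right _ (by omega)
    omega
  push Not at hdeg
  obtain ⟨z, hz⟩ := hdeg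
  -- the deletion bookkeeping
  have hK' := k4mFree_del D hK z
  have hcard' := card_del z
  have hedges' := card_edges_del D z
  have hsq := sum_deg_sq_del D z
  have hT := sum_del_nbhd_le D z (Fintype.card W - 6) hcap6
  have hNz := card_nbhd_del D z
  obtain ⟨T, hTdef⟩ : ∃ T, ∑ a : {v : W // v ≠ z}, (if D.Adj a.1 z then deg (del D z) a else 0) = T := ⟨_, rfl⟩
  obtain ⟨S', hS'def⟩ : ∃ S', ∑ a : {v : W // v ≠ z}, deg (del D z) a * deg (del D z) a = S' := ⟨_, rfl⟩
  obtain ⟨m', hm'def⟩ : ∃ m', (del D z).edgeFinset.card = m' := ⟨_, rfl⟩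
  obtain ⟨Nz, hNzdef⟩ : ∃ Nz : Finset {v : W // v ≠ z},
      Nz = univ.filter (fun a : {v : W // v ≠ z} => D.Adj a.1 z) := ⟨_, rfl⟩
  have hmemNz : ∀ a : {v : W // v ≠ z}, a ∈ Nz ↔ D.Adj a.1 z := fun a => by
    rw [hNzdef, mem_filter]
    simp only [mem_univ, true_and]
  rw [← hNzdef] at hNz
  rw [hTdef, hS'def] at hsq
  rw [hTdef] at hT
  rw [hm'def] at hedges'
  obtain ⟨s, hs⟩ : ∃ s, Fintype.card W = s + 11 := ⟨Fintype.card W - 11, by omega⟩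
  have hcardW' : Fintype.card {v : W // v ≠ z} = s + 10 := by omega
  -- the side lemma for a `4`-bipartite `D − z`
  have hside : ∀ A' : Finset {v : W // v ≠ z}, A'.card = 4 → BipSub (del D z) A' →
      (∃ A : Finset W, A.card = 4 ∧ BipSub D A) ∨
        (∑ v, deg D v * deg D v + 3 * (Fintype.card W - 4) + (2 * Fintype.card W - 18) ≤
          D.edgeFinset.card * Fintype.card W) ∨
        (T + (Fintype.card W - 6) ≤ deg D z * (Fintype.card W - 6) + 4) := by
    intro A' hA'card hB
    have := four_three_sides D hk hm z A' hA'card hB hcap6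
    rw [hTdef] at this
    exact this
  have hd : deg D z = 0 ∨ deg D z = 1 ∨ deg D z = 2 ∨ deg D z = 3 ∨ deg D z = 4 := by omega
  rcases hd with hd0 | hd1 | hd2 | hd3 | hd4
  · -- `d = 0`: the closed form on `(k − 1, 5, k − 11)`
    right
    have hm'0 : m' = 4 * s + 25 := by omega
    have h := closed_form_stability (del D z) hK' 5 (s + 11 - 11) (by norm_num) (by rw [hcardW']; omega)
      (by rw [hm'def, hcardW', hm'0]; omega)
    rw [hS'def, hm'def, hcardW'] at h
    have e : s + 10 - 1 - (s + 11 - 11) = 9 := by omega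
    rw [e] at h
    rw [hd0, hs] at hT
    rw [hsq, ← hedges', hs, hd0]
    exact four_three_del_zero_arith s m' S' T hm'0 h hT
  · -- `d = 1`: the diagonal `(k − 1, 4, 0)` at second order
    have hm'1 : m' = 4 * s + 24 := by omega
    rcases diag_second_order_gen (del D z) hK' 4 (le_refl 4) (by omega) (by rw [hm'def, hcardW', hm'1]; omega)
      with ⟨A', hA'card, hB⟩ | hgap
    · rcases hside A' hA'card hB with h | h | hT'
      · exact Or.inl h
      · exact Or.inr h
      · right
        have henv := sum_deg_sq_le_of_k4mFree (del D z) hK' (by omega)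
        rw [hS'def, hm'def, hcardW'] at henv
        rw [hs, hd1] at hT'
        rw [hsq, ← hedges', hs, hd1]
        exact four_three_del_one_bip_arith s m' S' T hm'1 henv (by omega)
    · right
      rw [hS'def, hm'def, hcardW'] at hgap
      rw [hd1, hs] at hT
      rw [hsq, ← hedges', hs, hd1]
      exact four_three_del_one_gap_arith s m' S' T hm'1 hgap hT
  · -- `d = 2`: the cell `(k − 1, 4, 1)`
    have hm'2 : m' = 4 * s + 23 := by omega
    rcases one_below_second_order_gen (del D z) hK' 4 (le_refl 4) (by omega)
      (by rw [hm'def, hcardW', hm'2]; omega) with ⟨A', hA'card, hB⟩ | hgap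
    · rcases hside A' hA'card hB with h | h | hT'
      · exact Or.inl h
      · exact Or.inr h
      · right
        have hS := sum_deg_sq_le_of_bipSub (del D z) A' hB 4 1 hA'card (by rw [hm'def, hcardW', hm'2]; omega)
          (by omega)
        rw [hS'def, hm'def, hcardW'] at hS
        rw [hs, hd2] at hT'
        rw [hsq, ← hedges', hs, hd2]
        exact four_three_del_two_mixed_arith s m' S' T hm'2 hS hT'
    · right
      rw [hS'def, hm'def, hcardW'] at hgap
      rw [hd2, hs] at hT
      rw [hsq, ← hedges', hs, hd2]
      exact four_three_del_two_gap_arith s m' S' T hm'2 hgap hT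
  · -- `d = 3`: the cell `(k − 1, 4, 2)`
    have hm'3 : m' = 4 * s + 22 := by omega
    rcases four_two_second_order (del D z) hK' (by omega) (by rw [hm'def, hcardW', hm'3]; omega)
      with ⟨A', hA'card, hB⟩ | hgap
    · rcases hside A' hA'card hB with h | h | hT'
      · exact Or.inl h
      · exact Or.inr h
      · right
        have hS := sum_deg_sq_le_of_bipSub (del D z) A' hB 4 2 hA'card (by rw [hm'def, hcardW', hm'3]; omega)
          (by omega)
        rw [hS'def, hm'def, hcardW'] at hS
        rw [hs, hd3] at hT'
        rw [hsq, ← hedges', hs, hd3]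
        exact four_three_del_three_mixed_arith s m' S' T hm'3 hS hT'
    · right
      rw [hS'def, hm'def, hcardW'] at hgap
      rw [hd3, hs] at hT
      rw [hsq, ← hedges', hs, hd3]
      exact four_three_del_three_gap_arith s m' S' T hm'3 hgap hT
  · -- `d = 4`: the cell `(k − 1, 4, 3)`
    have hm'4 : m' = 4 * s + 21 := by omega
    rcases Nat.eq_zero_or_pos s with hs0 | hspos
    · -- the corner `k = 11`: `D − z` on `(10, 21)` at third order
      subst hs0
      have hk11 : Fintype.card W = 11 := by omega
      have hcard10 : Fintype.card {v : W // v ≠ z} = 10 := by omega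
      have hm'21 : m' = 21 := by omega
      rcases three_diag_third_order_ten (del D z) hK' hcard10 (by rw [hm'def, hm'21])
        with ⟨A', hA'card, hA'⟩ | ⟨A', hA'card, hB⟩ | hthird
      · -- `D − z = K_{3,7}`: the four neighbours of `z` lie off the `3`-side
        have hfull : ∀ {x y : {v : W // v ≠ z}}, x ∈ A' → y ∉ A' → (del D z).Adj x y := fun hx hy =>
          adj_of_bipSub_full (del D z) A' hA' 3 hA'card (by rw [hm'def, hcard10, hm'21]) hx hy
        have hall : ¬ ∀ a : {v : W // v ≠ z}, D.Adj a.1 z → a ∈ A' := by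
          intro hall
          have hsub : Nz ⊆ A' := fun a ha => hall a ((hmemNz a).mp ha)
          have := card_le_card hsub
          omega
        push Not at hall
        obtain ⟨a₀, ha₀z, ha₀A⟩ := hall
        have hoff : ∀ a : {v : W // v ≠ z}, D.Adj a.1 z → a ∉ A' := by
          intro a₁ ha₁z ha₁A
          have hne01 : a₀ ≠ a₁ := fun h => ha₀A (h ▸ ha₁A)
          obtain ⟨a₂, ha₂z, ha₂0, ha₂1⟩ : ∃ a₂ : {v : W // v ≠ z}, D.Adj a₂.1 z ∧ a₂ ≠ a₀ ∧ a₂ ≠ a₁ := by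
            have h2 : 2 < Nz.card := by omega
            obtain ⟨b₁, hb₁, b₂, hb₂, b₃, hb₃, h12, h13, h23⟩ := two_lt_card.mp h2
            rw [hmemNz] at hb₁ hb₂ hb₃
            by_cases e1 : b₁ = a₀ ∨ b₁ = a₁
            · by_cases e2 : b₂ = a₀ ∨ b₂ = a₁
              · refine ⟨b₃, hb₃, ?_, ?_⟩
                · intro h; rcases e1 with rfl | rfl <;> rcases e2 with rfl | rfl <;>
                    first | exact h12 rfl | exact h13 h | exact h13 h.symm | exact h23 h | exact h23 h.symm
                · intro h; rcases e1 with rfl | rfl <;> rcases e2 with rfl | rfl <;>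
                    first | exact h12 rfl | exact h13 h | exact h13 h.symm | exact h23 h | exact h23 h.symm
              · push Not at e2
                exact ⟨b₂, hb₂, e2.1, e2.2⟩
            · push Not at e1
              exact ⟨b₁, hb₁, e1.1, e1.2⟩
          have h10 : D.Adj a₁.1 a₀.1 := (del_adj D z a₁ a₀).mp (hfull ha₁A ha₀A)
          by_cases ha₂A : a₂ ∈ A'
          · have h20 : D.Adj a₂.1 a₀.1 := (del_adj D z a₂ a₀).mp (hfull ha₂A ha₀A)
            exact not_adj_both D hK (D.adj_symm ha₀z) (D.adj_symm ha₁z) (D.adj_symm h10)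
              (fun h => ha₂1 (Subtype.ext h).symm) (D.adj_symm ha₂z) (D.adj_symm h20)
          · have h12' : D.Adj a₁.1 a₂.1 := (del_adj D z a₁ a₂).mp (hfull ha₁A ha₂A)
            exact not_adj_both D hK (D.adj_symm ha₁z) (D.adj_symm ha₀z) h10
              (fun h => ha₂0 (Subtype.ext h).symm) (D.adj_symm ha₂z) h12'
        obtain ⟨B, hBcard, hB⟩ := bipSub_insert_of_nbhd_off D z A' hA' hoff
        exact Or.inl ⟨B, by rw [hBcard, hA'card], hB⟩
      · -- `D − z` is `4`-bipartite on `(10, 4, 3)`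
        rcases hside A' hA'card hB with h | h | hT'
        · exact Or.inl h
        · exact Or.inr h
        · right
          have hS := sum_deg_sq_le_of_bipSub (del D z) A' hB 4 3 hA'card (by rw [hm'def, hcard10, hm'21])
            (by omega)
          rw [hS'def, hm'def, hcard10, hm'21] at hS
          rw [hk11, hd4] at hT'
          rw [hsq, ← hedges', hk11, hd4, hm'21]
          omega
      · -- `D − z` neither `3`- nor `4`-bipartite: at most `190`
        right
        rw [hS'def, hm'def, hcard10, hm'21] at hthird
        rw [hd4, hk11] at hT
        rw [hsq, ← hedges', hk11, hd4, hm'21]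
        omega
    · -- `k ≥ 12`: the induction hypothesis on `(k − 1, 4, 3)`
      rcases ih (Fintype.card {v : W // v ≠ z}) (by omega) {v : W // v ≠ z} (del D z) rfl hK' (by omega)
        (by rw [hm'def, hcardW', hm'4]; omega) with ⟨A', hA'card, hB⟩ | hgap
      · rcases hside A' hA'card hB with h | h | hT'
        · exact Or.inl h
        · exact Or.inr h
        · right
          have hS := sum_deg_sq_le_of_bipSub (del D z) A' hB 4 3 hA'card (by rw [hm'def, hcardW', hm'4]; omega)
            (by omega)
          rw [hS'def, hm'def, hcardW'] at hS
          rw [hs, hd4] at hT'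
          rw [hsq, ← hedges', hs, hd4]
          exact four_three_del_four_mixed_arith s m' S' T hm'4 hS hT'
      · right
        rw [hS'def, hm'def, hcardW'] at hgap
        rw [hd4, hs] at hT
        rw [hsq, ← hedges', hs, hd4]
        exact four_three_del_four_gap_arith s m' S' T hm'4 hgap hT

/-- **THE ROW `a = 4` AT `r = 3` AT SECOND ORDER:** `K₄⁻`-free, `m + 3 = 4 (k − 4)`, `11 ≤ k` ⇒ `D` is a spanning
subgraph of some `K(A, Aᶜ)` with `|A| = 4`, or `Σ_v d(v)² + 3 (k − 4) + (2k − 18) ≤ m k` (the non-bipartite gap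
`B2 = 2k − 18`). -/
theorem four_three_second_order (D : SimpleGraph V) [DecidableRel D.Adj] (hK : K4mFree D)
    (hk : 11 ≤ Fintype.card V) (hm : D.edgeFinset.card + 3 = 4 * (Fintype.card V - 4)) :
    (∃ A : Finset V, A.card = 4 ∧ BipSub D A) ∨
      ∑ v, deg D v * deg D v + 3 * (Fintype.card V - 4) + (2 * Fintype.card V - 18) ≤
        D.edgeFinset.card * Fintype.card V :=
  four_three_second_order_aux (Fintype.card V) V D rfl hK hk hm

/-- **THE CORNER `(11, 4, 3)`:** a `K₄⁻`-free graph with `25` edges on `11` vertices is `4`-bipartite or has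
`Σ_v d(v)² ≤ 250 = m k − 3 (k − 4) − 4` (the census: gap `4`, `15,246` maximisers). -/
theorem four_three_corner (D : SimpleGraph V) [DecidableRel D.Adj] (hK : K4mFree D)
    (hk : Fintype.card V = 11) (hm : D.edgeFinset.card = 25) :
    (∃ A : Finset V, A.card = 4 ∧ BipSub D A) ∨ ∑ v, deg D v * deg D v ≤ 250 := by
  rcases four_three_second_order D hK (by omega) (by omega) with h | h
  · exact Or.inl h
  · right
    rw [hk, hm] at h
    omega

end C047

end TriangleCap

end PercRepro
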